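import Summits.FinalStateConjecture.FinalStateConjecture.Theorems.PhotonSphereChannelsChannelsResolveTameDevelopmentsRTrappedSetPresentation
import Summits.FinalStateConjecture.FinalStateConjecture.Theorems.PhotonSphereChannelsChannelsResolveTameDevelopmentsRTrappedSetFlatExterior
import Literature.Geometry.Lorentzian.KerrSchildChartCovariance
import HarnessLib

/-!
# Crux `ChannelsResolveTameDevelopmentsR` (stmt-FinalStateConjecture-14075), line
# `trapped-set-observability-analyticity` — stub `stub_harmonicPresentation` (S3', Reshape 1),
# wave 2: the Minkowski tame eternal limit WITH ITS MODEL EXPOSED, the identity presentation of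
# EVERY Minkowski-modelled limit, and the eternal collar slab of the presentation cylinder

Helper lemmas for the reshaped stub S3' (`stub_harmonicPresentation`:
`(∃ κ₀ > 0, E.RedShifted κ₀) → E.HasSphericalHorizonSections → ∃ a r₀ Ξ, E.IsPresentedBy a r₀ Ξ`),
written over the landed part-1 vocabulary (`TameEternalLimit`, `.doc`, `.horizon`, `.RedShifted`;
`PhotonSphereChannelsTameEternalLimitDefs.lean`) with the presentation cylinder and background
UNFOLDED (`{x : E4 | r₀ < Kerr.radius a x}`, `⟨⟨{…}, _⟩, 0, x⁰, r(a,·)⟩` — `rfl`-equal to the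
part-2 names `cyl a r₀` / `presentationBackground a r₀` of
`PhotonSphereChannelsPresentedExteriorDefs.lean`, p110780, whose build the farm had not yet served
when this file was checked; the NAMED corollaries — `IsPresentedBy` assembled — sit in the
companion file `…TrappedSetPresentationCollar.lean`, which imports this one).

* §1 THE ETERNAL COLLAR SLAB (audit A3'(ii) of `work/stubs/stub_harmonicPresentation_v2.md`): the
  Kerr–Schild radius of the axis point `r e₃ + s e₀` is `r` (`r ≥ 0`), so every radius level
  `r > r₀`, `r ≥ 0` is met in the cylinder at EVERY coordinate time, and for `0 ≤ r₀` the
  excision collar `{r₀ < r < r₀ + δ}` of the `dark` clause is NONEMPTY at every `x⁰` (for `r₀ < 0`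
  it is empty: p107942) — registered sub-goal `stub_collarSlabEternal`.
* §2 THE MINKOWSKI LIMIT WITH ITS MODEL EXPOSED: the witness of `stub_tameEternalLimitNonempty`
  (p100126: `Z = (ℝ⁴, η, ∂₀)`, `z = 0`, `M = 0`, `R = 1`, far chart the inclusion, clock `x⁰`,
  `L = 0`) rebuilt from that file's lemmas, now recording the conjunct `E.Z = Minkowski.spacetime`
  (and `RedShifted κ₀` for every `κ₀`), so that statements about MINKOWSKI-MODELLED limits apply to
  it by `obtain ⟨E, hZ, …⟩; subst` with no further rebuild — registered sub-goal
  `stub_minkowskiModelLimitExposed`.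
* §3 EVERY MINKOWSKI-MODELLED LIMIT IS PRESENTED BY THE IDENTITY CHART (whatever its far chart,
  clock, base point, generator field): for every `a` and `r₀ < 0`, `Ξ = ι : {r₀ < r(a,·)} = E4 → Z`
  is a SURJECTIVE injective local diffeomorphism covering `closure doc`, future-oriented for its
  presented components, which are the constant `η` — the four `G`-independent fields of
  `IsPresentedBy` for the limit itself (p106294 proved them for the bare chart) — and, by p107942
  (`stub_flatIsPresentedDarkExterior`), the fifth (`dark`) holds for these components: registered
  sub-goal `stub_minkowskiModelledIdentityPresentation`.
-/

set_option linter.dupNamespace false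

noncomputable section

namespace Summit.FinalStateConjecture.FinalStateConjecture.Theorems.TrappedSet

open Literature.Geometry.Lorentzian
open Summit.FinalStateConjecture.FinalStateConjecture.Theorems.ZeroEnergyRigidity.Negative
open scoped Manifold ContDiff Topology ENNReal NNReal
open Filter Set Function TopologicalSpace

/-! ## §1 The eternal collar slab of the presentation cylinder -/

section CollarSlab

/-- The oblate radius of the axis point `r e₃ + s e₀` (`r ≥ 0`) is `r`: the Kerr–Schild radius
ignores `x⁰` and equals `|z|` on the polar axis. [cite: arXiv07060622, (35)] -/
theorem kerr_radius_axisPoint (a s : ℝ) {r : ℝ} (hr : 0 ≤ r) :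
    Kerr.radius a (r • E4.basisVector 3 + s • E4.basisVector 0) = r := by
  rw [Kerr.radius_add_time_smul_basisVector, KerrSchildChart.radius_polar a hr]

/-- **Every radius level `r ≥ 0` above the excision is met in the cylinder `{r₀ < r(a,·)}` at
every coordinate time**: `r e₃ + s e₀` has `x⁰ = s` and `r(a, ·) = r`. [folklore] -/
theorem exists_mem_setOf_lt_radius_eq (a : ℝ) {r₀ r : ℝ} (hr : 0 ≤ r) (h : r₀ < r) (s : ℝ) :
    ∃ x ∈ {x : E4 | r₀ < Kerr.radius a x}, x 0 = s ∧ Kerr.radius a x = r := by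
  refine ⟨r • E4.basisVector 3 + s • E4.basisVector 0, ?_, by simp, kerr_radius_axisPoint a s hr⟩
  rw [mem_setOf_eq, kerr_radius_axisPoint a s hr]
  exact h

/-- **For `0 ≤ r₀` the excision collar `{x | r₀ < r(a,x) < r₀ + δ}` of the `dark` clause is an
honest ETERNAL slab** — nonempty at every coordinate time `x⁰ = s` (witness on the polar axis at
radius `r₀ + δ/2`).  Contrast `r₀ < 0`: there `r ≥ 0 ≥ r₀ + δ` for `δ ≤ -r₀` makes the collar
clause vacuous (`stub_flatIsPresentedDarkExterior`). [folklore] -/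
theorem exists_mem_collar_setOf (a : ℝ) {r₀ δ : ℝ} (hr₀ : 0 ≤ r₀) (hδ : 0 < δ) (s : ℝ) :
    ∃ x ∈ {x : E4 | r₀ < Kerr.radius a x}, x 0 = s ∧ Kerr.radius a x < r₀ + δ := by
  obtain ⟨x, hx, hs, hr⟩ :=
    exists_mem_setOf_lt_radius_eq a (r₀ := r₀) (r := r₀ + δ / 2) (by linarith) (by linarith) s
  exact ⟨x, hx, hs, by rw [hr]; linarith⟩

end CollarSlab

/-- Registered sub-goal `stub_collarSlabEternal` of `stub_harmonicPresentation` (S3'): for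
`0 ≤ r₀` and `δ > 0` the collar slab of the presentation cylinder meets every coordinate-time
level. [folklore] -/
theorem stub_collarSlabEternal :
    ∀ (a r₀ δ s : ℝ), 0 ≤ r₀ → 0 < δ → ∃ x ∈ {x : E4 | r₀ < Kerr.radius a x}, x 0 = s ∧ Kerr.radius a x < r₀ + δ :=
  fun a _ _ s hr₀ hδ ↦ exists_mem_collar_setOf a hr₀ hδ s

/-! ## §2 The Minkowski tame eternal limit, model exposed -/

section MinkowskiModel

/-- **The Minkowski tame eternal limit, with its model exposed.**  Exact Minkowski space
`(ℝ⁴, η, ∂₀)` with base point `0`, `M = 0`, `R = 1`, far chart the inclusion of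
`ℝ_t × {|x| > 1}`, clock `x⁰`, `L = 0` is a `TameEternalLimit` with empty horizon and d.o.c.
everything — the witness of `stub_tameEternalLimitNonempty` (p100126), rebuilt field by field
from that file's lemmas, with the conjunct `E.Z = Minkowski.spacetime` EXPOSED so that
statements about Minkowski-modelled limits apply to it without another rebuild. [folklore] -/
theorem exists_tameEternalLimit_Z_eq_minkowski :
    ∃ E : TameEternalLimit, E.Z = Minkowski.spacetime ∧ E.M = 0 ∧ E.R = 1 ∧
      E.horizon = ∅ ∧ E.doc = Set.univ := by
  -- adapted from p100126 `stub_tameEternalLimitNonempty` (same fields, same proofs)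
  refine ⟨
    { Z := Minkowski.spacetime
      z := (0 : E4)
      M := 0
      R := 1
      Φ := Subtype.val
      t := fun x : E4 ↦ x 0
      L := fun _ ↦ 0
      mass_nonneg := le_rfl
      lt_R := by norm_num
      isRicciFlat := by
        intro hLC
        haveI : Minkowski.smoothMetric.toPseudoRiemannianMetric.HasLeviCivita := hLC
        exact Minkowski.isRicciFlat_holds
      isGloballyHyperbolic := Minkowski.isGloballyHyperbolic
      subset_chronologicalFuture := by
        change (univ : Set E4) ⊆ (LorentzianMetric.ofLE (n' := (∞ : ℕ∞ω)) Minkowski.metric le_top).chronologicalFuture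
          (TimeOrientation.ofLE (n' := (∞ : ℕ∞ω)) Minkowski.timeOrientation le_top)
          (Set.range (Subtype.val : Kerr.region (0 : ℝ) 1 → E4))
        rw [chronologicalFuture_farCylinder_eq_univ]
      isLocalDiffeomorph_far := isLocalDiffeomorph_subtypeVal_minkowski _
      injective_far := Subtype.val_injective
      far_bounds k := ⟨0, fun m _ x ↦ by
        rw [deviationExtend_minkowski_farChart, iteratedFDeriv_zero (𝕜 := ℝ)]
        simp⟩
      far_nonradiating m δ hδ := ⟨0, fun x _ ↦ by
        have h0 : (fun y : E4 ↦ fderiv ℝ (Minkowski.spacetime.deviationExtend (farBackground 0 1)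
            (Subtype.val : Kerr.region (0 : ℝ) 1 → E4)) y (Literature.Geometry.Lorentzian.E4.basisVector 0)) = 0 := by
          funext y
          rw [deviationExtend_minkowski_farChart]
          simp
        rw [h0, iteratedFDeriv_zero (𝕜 := ℝ)]
        simpa using hδ.le⟩
      far_clock _ := rfl
      contMDiff_clock := contMDiff_iff_contDiff.mpr (contDiff_piLp_apply (p := 2))
      tame k := ⟨1, one_pos, 0, fun q _ ↦ tameClockChartAt_minkowski k one_pos 0 q⟩
      basepoint_mem := by
        change (0 : E4) ∈ closure (Minkowski.spacetime.docOfEnd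
          (Set.range (Subtype.val : Kerr.region (0 : ℝ) 1 → E4)))
        rw [docOfEnd_farCylinder_eq_univ, closure_univ]
        exact mem_univ _
      contMDiffOn_generator := ⟨∅, isOpen_empty, by rw [futureEventHorizonOfEnd_farCylinder_eq_empty],
        fun _ h ↦ h.elim⟩
      generator_null p hp := by
        rw [futureEventHorizonOfEnd_farCylinder_eq_empty] at hp
        exact hp.elim
      generator_tangent γ _ h0 := by
        rw [futureEventHorizonOfEnd_farCylinder_eq_empty] at h0
        exact h0.elim
      generator_complete p hp := by
        rw [futureEventHorizonOfEnd_farCylinder_eq_empty] at hp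
        exact hp.elim
      horizon_regular := by
        refine ⟨∅, fun _ ↦ 0, isOpen_empty, ?_, fun _ h ↦ h.elim, ?_, ?_⟩
        · rw [futureEventHorizonOfEnd_farCylinder_eq_empty]
        · rw [futureEventHorizonOfEnd_farCylinder_eq_empty]
          ext p
          simp
        · intro p hp
          rw [futureEventHorizonOfEnd_farCylinder_eq_empty] at hp
          exact hp.elim
      isCompact_horizonSlice c := by
        rw [futureEventHorizonOfEnd_farCylinder_eq_empty, empty_inter]
        exact isCompact_empty
      nonexpanding := by
        intro _ p hp
        rw [futureEventHorizonOfEnd_farCylinder_eq_empty] at hp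
        exact hp.elim }, rfl, rfl, rfl, ?_, ?_⟩
  · change Minkowski.spacetime.futureEventHorizonOfEnd
      (Set.range (Subtype.val : Kerr.region (0 : ℝ) 1 → E4)) = ∅
    exact futureEventHorizonOfEnd_farCylinder_eq_empty 1
  · change Minkowski.spacetime.docOfEnd (Set.range (Subtype.val : Kerr.region (0 : ℝ) 1 → E4)) = univ
    exact docOfEnd_farCylinder_eq_univ 1

end MinkowskiModel

/-- Registered sub-goal `stub_minkowskiModelLimitExposed` of `stub_harmonicPresentation` (S3'):
the Minkowski tame eternal limit exists WITH ITS MODEL EXPOSED (`E.Z = Minkowski.spacetime`,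
`M = 0`, `R = 1`, empty horizon, d.o.c. everything) and is `RedShifted κ₀` for every `κ₀`
(vacuously, `redShifted_of_horizon_eq_empty`) — the hypotheses of S3'/S6 hold on it. [folklore] -/
theorem stub_minkowskiModelLimitExposed :
    ∃ E : TameEternalLimit, E.Z = Minkowski.spacetime ∧ E.M = 0 ∧ E.R = 1 ∧ E.horizon = ∅ ∧ E.doc = Set.univ ∧ ∀ [E.Z.metric.toPseudoRiemannianMetric.HasLeviCivita], ∀ κ₀ : ℝ, E.RedShifted κ₀ := by
  obtain ⟨E, hZ, hM, hR, h𝓗, hdoc⟩ := exists_tameEternalLimit_Z_eq_minkowski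
  exact ⟨E, hZ, hM, hR, h𝓗, hdoc, fun κ₀ ↦ E.redShifted_of_horizon_eq_empty h𝓗 κ₀⟩

/-! ## §3 Every Minkowski-modelled limit is presented by the identity chart -/

section IdentityPresentation

/-- **The identity presentation of a Minkowski-modelled tame eternal limit** (unfolded fields of
`IsPresentedBy`, for the LIMIT rather than for the bare chart of p106294): if
`E.Z = Minkowski.spacetime` then for every `a` and every `r₀ < 0` the inclusion
`ι : {r₀ < r(a,·)} (= E4) → Z` is a surjective injective local diffeomorphism covering
`closure ⟨⟨Φ⟩⟩`, future-oriented for its presented components `deviationExtend ⟨cyl, 0, x⁰, r⟩ ι`,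
and these are the constant `η` — whatever the far chart, clock, base point and generator field of
`E` are (`subst` the model; then p106294's lemmas). With `stub_flatIsPresentedDarkExterior`
(p107942) for the constant components this is all five fields of `IsPresentedBy a r₀ ι`.
[folklore] -/
theorem TameEternalLimit.identityPresentation_of_Z_eq_minkowski (E : TameEternalLimit)
    (hZ : E.Z = Minkowski.spacetime) (a : ℝ) {r₀ : ℝ} (h : r₀ < 0) :
    ∃ Ξ : (⟨{x : E4 | r₀ < Kerr.radius a x}, isOpen_lt continuous_const (Kerr.continuous_radius a)⟩ :
        Opens E4) → E.Z.carrier,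
      Function.Surjective Ξ ∧ IsLocalDiffeomorph 𝓘(ℝ, E4) (𝓡 4) (⊤ : ℕ∞) Ξ ∧ Function.Injective Ξ ∧
      closure E.doc ⊆ Set.range Ξ ∧
      (∀ x : (⟨{x : E4 | r₀ < Kerr.radius a x}, isOpen_lt continuous_const (Kerr.continuous_radius a)⟩ :
          Opens E4),
        E.Z.timeOrientation.IsFutureDirected (mfderiv 𝓘(ℝ, E4) (𝓡 4) Ξ x
          (-(MetricCoord.sharpAt (E.Z.deviationExtend
            ⟨⟨{x : E4 | r₀ < Kerr.radius a x}, isOpen_lt continuous_const (Kerr.continuous_radius a)⟩,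
              0, fun y ↦ y 0, Kerr.radius a⟩ Ξ) x.1 (E4.dx 0))))) ∧
      E.Z.deviationExtend
          ⟨⟨{x : E4 | r₀ < Kerr.radius a x}, isOpen_lt continuous_const (Kerr.continuous_radius a)⟩,
            0, fun y ↦ y 0, Kerr.radius a⟩ Ξ = fun _ ↦ Minkowski.bilin := by
  obtain ⟨Z, z, M, R, Φ, t, L, h1, h2, h3, h4, h5, h6, h7, h8, h9, h10, h11, h12, h13, h14, h15, h16,
    h17, h18, h19, h20⟩ := E
  dsimp only at hZ
  subst hZ
  exact ⟨Subtype.val, fun y ↦ ⟨⟨y, h.trans_le (Kerr.radius_nonneg a y)⟩, rfl⟩,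
    isLocalDiffeomorph_subtypeVal_minkowski _, Subtype.val_injective,
    subset_range_cyl_subtypeVal a h _, isFutureDirected_identityPresentation a h,
    deviationExtend_cyl_subtypeVal_minkowski a h⟩

end IdentityPresentation

/-- Registered sub-goal `stub_minkowskiModelledIdentityPresentation` of `stub_harmonicPresentation`
(S3'): statement of `TameEternalLimit.identityPresentation_of_Z_eq_minkowski` as a closed `Prop`.
[folklore] -/
theorem stub_minkowskiModelledIdentityPresentation :
    ∀ (E : TameEternalLimit), E.Z = Minkowski.spacetime → ∀ (a r₀ : ℝ), r₀ < 0 → ∃ Ξ : (⟨{x : E4 | r₀ < Kerr.radius a x}, isOpen_lt continuous_const (Kerr.continuous_radius a)⟩ : Opens E4) → E.Z.carrier, Function.Surjective Ξ ∧ IsLocalDiffeomorph 𝓘(ℝ, E4) (𝓡 4) (⊤ : ℕ∞) Ξ ∧ Function.Injective Ξ ∧ closure E.doc ⊆ Set.range Ξ ∧ (∀ x : (⟨{x : E4 | r₀ < Kerr.radius a x}, isOpen_lt continuous_const (Kerr.continuous_radius a)⟩ : Opens E4), E.Z.timeOrientation.IsFutureDirected (mfderiv 𝓘(ℝ, E4)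 (𝓡 4) Ξ x (-(MetricCoord.sharpAt (E.Z.deviationExtend ⟨⟨{x : E4 | r₀ < Kerr.radius a x}, isOpen_lt continuous_const (Kerr.continuous_radius a)⟩, 0, fun y ↦ y 0, Kerr.radius a⟩ Ξ) x.1 (E4.dx 0))))) ∧ E.Z.deviationExtend ⟨⟨{x : E4 | r₀ < Kerr.radius a x}, isOpen_lt continuous_const (Kerr.continuous_radius a)⟩, 0, fun y ↦ y 0, Kerr.radius a⟩ Ξ = fun _ ↦ Minkowski.bilin :=
  fun E hZ a _ h ↦ E.identityPresentation_of_Z_eq_minkowski hZ a h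

end Summit.FinalStateConjecture.FinalStateConjecture.Theorems.TrappedSet

end
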